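import Summits.Ventures.PercRepro.S1FiveCircuitsSolidCaseOneA

/-!
# PercRepro — THE SOLID ANALYSIS, CASE 1 (PART B): A 7-POINT SOLID THROUGH `e` AT NULLITY `4` LEAVES `≤ 16` FIVE-CIRCUITS THROUGH `e` (p1, gen 33)

`proofs/P1-S2-CORANK6.md` §4l, Proposition B′: `not_two_triangles_of_hfree` (no four-point line through `e`) and
**`ncard_fiveCircuitsThrough_le_sixteen_of_seven_solid`** — on a spread e-free core of nullity `4`, if some rank-`4` flat `cl(X)` through `e` has
`7` points, at most `16` five-circuits pass through `e` (`15 + 1`, or `14 + 2` along the swap circuit); `…_circuit` = the five-circuit form.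
Part A = `S1FiveCircuitsSolidCaseOneA`.
Axioms: standard.
-/

open scoped Matroid

namespace PercRepro

namespace S1

open Set

open FourCap

variable {α : Type}
/-- **No four-point line through a point of an e-free core**: two circuits `{e, x, y}` and `{e, x', y}` with `x ≠ x'` are
impossible — `y, x, x'` all lie on the line `cl{e, y}` of rank `2`, so `e` lies in the closure of any two of them, and two of the
three lie on one side of the partition at `e`. -/
theorem not_two_triangles_of_hfree (M : Matroid α) [M.Finite]
    (hfree : ∀ e ∈ M.E, ∃ A ⊆ M.E \ {e}, e ∉ M.closure A ∧ e ∉ M.closure ((M.E \ {e}) \ A))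
    {e x x' y : α} (hK : M.IsCircuit {e, x, y}) (hK' : M.IsCircuit {e, x', y}) (hxx' : x ≠ x') (hex : e ≠ x)
    (hex' : e ≠ x') (hey : e ≠ y) (hxy : x ≠ y) (hx'y : x' ≠ y) : False := by
  have heE : e ∈ M.E := hK.subset_ground (mem_insert _ _)
  have hxE : x ∈ M.E := hK.subset_ground (mem_insert_of_mem _ (mem_insert _ _))
  have hx'E : x' ∈ M.E := hK'.subset_ground (mem_insert_of_mem _ (mem_insert _ _))
  have hyE : y ∈ M.E := hK.subset_ground (mem_insert_of_mem _ (mem_insert_of_mem _ (mem_singleton y)))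
  have hxL : x ∈ M.closure {e, y} := by
    have h := hK.mem_closure_sdiff_singleton_of_mem
      (mem_insert_of_mem _ (mem_insert _ _) : x ∈ ({e, x, y} : Set α))
    rwa [insert_sdiff_of_notMem _ (by simp [hex]), pair_sdiff_left hxy] at h
  have hx'L : x' ∈ M.closure {e, y} := by
    have h := hK'.mem_closure_sdiff_singleton_of_mem
      (mem_insert_of_mem _ (mem_insert _ _) : x' ∈ ({e, x', y} : Set α))
    rwa [insert_sdiff_of_notMem _ (by simp [hex']), pair_sdiff_left hx'y] at h
  have hyL : y ∈ M.closure {e, y} :=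
    M.subset_closure {e, y} (pair_subset heE hyE) (mem_insert_of_mem _ (mem_singleton y))
  have hLr : M.eRk (M.closure {e, y}) = 2 := by
    rw [M.eRk_closure_eq, (indep_pair_of_hfree M hfree heE hyE hey).eRk_eq_encard, encard_pair hey]
  have hpair : ∀ p q, p ∈ M.closure {e, y} → q ∈ M.closure {e, y} → p ∈ M.E → q ∈ M.E → p ≠ q →
      e ∈ M.closure {p, q} := by
    intro p q hp hq hpE hqE hpq
    have hsub : M.closure {e, y} ⊆ M.closure {p, q} :=
      subset_closure_of_subset_of_eRk_le M (M.closure_subset_ground _) (pair_subset hp hq)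
        (by rw [hLr, (indep_pair_of_hfree M hfree hpE hqE hpq).eRk_eq_encard, encard_pair hpq])
    exact hsub (M.subset_closure {e, y} (pair_subset heE hyE) (mem_insert _ _))
  obtain ⟨A, _, heA, heB⟩ := hfree e heE
  have hside : ∀ p q, p ∈ M.closure {e, y} → q ∈ M.closure {e, y} → p ∈ M.E → q ∈ M.E → p ≠ q →
      ((p ∈ A ∧ q ∈ A) ∨ (p ∉ A ∧ q ∉ A ∧ p ≠ e ∧ q ≠ e)) → False := by
    intro p q hp hq hpE hqE hpq h
    rcases h with ⟨hpA, hqA⟩ | ⟨hpA, hqA, hpe, hqe⟩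
    · exact heA (M.closure_mono (pair_subset hpA hqA) (hpair p q hp hq hpE hqE hpq))
    · exact heB (M.closure_mono (pair_subset (show p ∈ (M.E \ {e}) \ A from ⟨⟨hpE, hpe⟩, hpA⟩)
        (show q ∈ (M.E \ {e}) \ A from ⟨⟨hqE, hqe⟩, hqA⟩)) (hpair p q hp hq hpE hqE hpq))
  by_cases hxA : x ∈ A <;> by_cases hx'A : x' ∈ A <;> by_cases hyA : y ∈ A
  · exact hside x x' hxL hx'L hxE hx'E hxx' (Or.inl ⟨hxA, hx'A⟩)
  · exact hside x x' hxL hx'L hxE hx'E hxx' (Or.inl ⟨hxA, hx'A⟩)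
  · exact hside x y hxL hyL hxE hyE hxy (Or.inl ⟨hxA, hyA⟩)
  · exact hside x' y hx'L hyL hx'E hyE hx'y (Or.inr ⟨hx'A, hyA, hex'.symm, hey.symm⟩)
  · exact hside x' y hx'L hyL hx'E hyE hx'y (Or.inl ⟨hx'A, hyA⟩)
  · exact hside x y hxL hyL hxE hyE hxy (Or.inr ⟨hxA, hyA, hex.symm, hey.symm⟩)
  · exact hside x x' hxL hx'L hxE hx'E hxx' (Or.inr ⟨hxA, hx'A, hex.symm, hex'.symm⟩)
  · exact hside x x' hxL hx'L hxE hx'E hxx' (Or.inr ⟨hxA, hx'A, hex.symm, hex'.symm⟩)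

/-- **CASE 1 OF `Q₅*_spread(4) ≤ 16`**: on a spread e-free core of nullity `4`, if some five-circuit `C₀ ∋ e` spans a 7-point
solid — more generally if some rank-`4` flat `S₀ = cl(X)` through `e` has `7` points — then at most `16` five-circuits pass through `e`
— `≤ 15` inside the solid, and outside either `≤ 1`, or exactly two
`C, C − y + x` along a circuit `{e, x, y}` inside the solid, which then carries `≤ 14` (no five-circuit through `e` contains both
`x` and `y`). -/
theorem ncard_fiveCircuitsThrough_le_sixteen_of_seven_solid (M : Matroid α) [M.Finite]
    (hfree : ∀ e ∈ M.E, ∃ A ⊆ M.E \ {e}, e ∉ M.closure A ∧ e ∉ M.closure ((M.E \ {e}) \ A))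
    (hns : ¬ ∃ W ⊆ M.E, W.ncard ≤ 9 ∧ W.encard = M.eRk W + 4) (hd : M.E.encard = M.eRank + 4)
    {e : α} {X : Set α} (hX4 : M.eRk X = 4) (heX : e ∈ M.closure X) (h7 : (M.closure X).ncard = 7) :
    {C : Set α | M.IsCircuit C ∧ C.ncard = 5 ∧ e ∈ C}.ncard ≤ 16 := by
  classical
  have hS₀E : M.closure X ⊆ M.E := M.closure_subset_ground X
  have hS₀f : (M.closure X).Finite := M.ground_finite.subset hS₀E
  have heS₀ : e ∈ M.closure X := heX
  have hS₀e : (M.closure X \ {e}).ncard = 6 := by rw [ncard_sdiff_singleton_of_mem heS₀, h7]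
  have hfinsub : ∀ s : Set (Set α), (∀ C ∈ s, M.IsCircuit C) → s.Finite := fun s hs =>
    M.ground_finite.finite_subsets.subset (fun C hC => (hs C hC).subset_ground)
  have hsplit : {C : Set α | M.IsCircuit C ∧ C.ncard = 5 ∧ e ∈ C} ⊆
      {C : Set α | M.IsCircuit C ∧ C.ncard = 5 ∧ e ∈ C ∧ C ⊆ M.closure X} ∪
        {C : Set α | M.IsCircuit C ∧ C.ncard = 5 ∧ e ∈ C ∧ ¬ C ⊆ M.closure X} := by
    intro C hC
    by_cases h : C ⊆ M.closure X
    · exact Or.inl ⟨hC.1, hC.2.1, hC.2.2, h⟩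
    · exact Or.inr ⟨hC.1, hC.2.1, hC.2.2, h⟩
  have hCinfin : {C : Set α | M.IsCircuit C ∧ C.ncard = 5 ∧ e ∈ C ∧ C ⊆ M.closure X}.Finite :=
    hfinsub _ (fun C hC => hC.1)
  have hOfin : {C : Set α | M.IsCircuit C ∧ C.ncard = 5 ∧ e ∈ C ∧ ¬ C ⊆ M.closure X}.Finite :=
    hfinsub _ (fun C hC => hC.1)
  have htot : {C : Set α | M.IsCircuit C ∧ C.ncard = 5 ∧ e ∈ C}.ncard ≤
      {C : Set α | M.IsCircuit C ∧ C.ncard = 5 ∧ e ∈ C ∧ C ⊆ M.closure X}.ncard +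
        {C : Set α | M.IsCircuit C ∧ C.ncard = 5 ∧ e ∈ C ∧ ¬ C ⊆ M.closure X}.ncard :=
    (ncard_le_ncard hsplit (hCinfin.union hOfin)).trans (ncard_union_le _ _)
  have hin15 : {C : Set α | M.IsCircuit C ∧ C.ncard = 5 ∧ e ∈ C ∧ C ⊆ M.closure X}.ncard ≤ 15 := by
    have := ncard_fiveCircuitsThrough_subset_le_choose M hS₀E e
    rw [hS₀e] at this
    exact this.trans (le_of_eq (by decide))
  by_cases hO1 : {C : Set α | M.IsCircuit C ∧ C.ncard = 5 ∧ e ∈ C ∧ ¬ C ⊆ M.closure X}.ncard ≤ 1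
  · omega
  push Not at hO1
  obtain ⟨C, C', hC, hC', hne⟩ := (one_lt_ncard_iff hOfin).1 hO1
  obtain ⟨x, y, hxS, hyS, hyC, hxC, hye, hxe, hC'eq, hK⟩ :=
    exists_swap_of_not_subset M hfree hns hd hX4 heX h7 hC.1 hC.2.1 hC.2.2.1 hC.2.2.2
      hC'.1 hC'.2.1 hC'.2.2.1 hC'.2.2.2 hne
  have hxy : x ≠ y := fun h => hxC (h ▸ hyC)
  -- (i) the outside circuits are `C` and `C'` only
  have hO2 : {C : Set α | M.IsCircuit C ∧ C.ncard = 5 ∧ e ∈ C ∧ ¬ C ⊆ M.closure X} ⊆ {C, C'} := by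
    intro C'' hC''
    by_cases h1 : C'' = C
    · exact Or.inl h1
    obtain ⟨x'', y'', hx''S, hy''S, hy''C, hx''C, hy''e, hx''e, hC''eq, hK''⟩ :=
      exists_swap_of_not_subset M hfree hns hd hX4 heX h7 hC.1 hC.2.1 hC.2.2.1 hC.2.2.2
        hC''.1 hC''.2.1 hC''.2.2.1 hC''.2.2.2 (Ne.symm h1)
    have hyy : y'' = y := by
      by_contra hne'
      have h2 := ncard_inter_le_two_of_not_subset M hns hX4 h7 hC.1 hC.2.1 hC.2.2.2
      have hsub : ({e, y, y''} : Set α) ⊆ C ∩ M.closure X := by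
        intro z hz
        simp only [mem_insert_iff, mem_singleton_iff] at hz
        rcases hz with rfl | rfl | rfl
        · exact ⟨hC.2.2.1, heS₀⟩
        · exact ⟨hyC, hyS⟩
        · exact ⟨hy''C, hy''S⟩
      have h3 : ({e, y, y''} : Set α).ncard = 3 :=
        ncard_eq_three.2 ⟨e, y, y'', hye.symm, hy''e.symm, Ne.symm hne', rfl⟩
      have := ncard_le_ncard hsub ((M.ground_finite.subset hC.1.subset_ground).subset inter_subset_left)
      omega
    subst hyy
    by_cases hxx : x'' = x
    · right
      rw [mem_singleton_iff, hC''eq, hC'eq, hxx]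
    · exfalso
      exact not_two_triangles_of_hfree M hfree hK hK'' (Ne.symm hxx) hxe.symm hx''e.symm hye.symm hxy
        (fun h => hx''C (h ▸ hyC))
  have hO2' : {C : Set α | M.IsCircuit C ∧ C.ncard = 5 ∧ e ∈ C ∧ ¬ C ⊆ M.closure X}.ncard ≤ 2 := by
    have := ncard_le_ncard hO2 ((finite_singleton C').insert C)
    rwa [ncard_pair hne] at this
  -- (ii) inside the solid, no five-circuit through `e` contains both `x` and `y`: at most `14`
  have hin14 : {C : Set α | M.IsCircuit C ∧ C.ncard = 5 ∧ e ∈ C ∧ C ⊆ M.closure X}.ncard ≤ 14 := by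
    have h3 : ({e, x, y} : Set α).ncard = 3 := ncard_eq_three.2 ⟨e, x, y, hxe.symm, hye.symm, hxy, rfl⟩
    have hKsub : ({e, x, y} : Set α) ⊆ M.closure X := by
      intro z hz
      simp only [mem_insert_iff, mem_singleton_iff] at hz
      rcases hz with rfl | rfl | rfl
      · exact heS₀
      · exact hxS
      · exact hyS
    have hrest : 2 ≤ (M.closure X \ {e, x, y}).ncard := by
      rw [ncard_sdiff' hKsub hS₀f, h7, h3]
      norm_num
    obtain ⟨P, hPS, hP2⟩ := Set.exists_subset_card_eq hrest
    have hPf : P.Finite := (hS₀f.subset sdiff_subset).subset hPS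
    have hdisj : Disjoint ({x, y} : Set α) P :=
      disjoint_left.2 (fun z hz hzP => (hPS hzP).2 (mem_insert_of_mem _ hz))
    have hbigfin : {A : Set α | A ⊆ M.closure X \ {e} ∧ A.ncard = 4}.Finite :=
      (hS₀f.subset sdiff_subset).finite_subsets.subset (fun A hA => hA.1)
    have hA₀ : {x, y} ∪ P ∈ {A : Set α | A ⊆ M.closure X \ {e} ∧ A.ncard = 4} := by
      refine ⟨union_subset (pair_subset ⟨hxS, hxe⟩ ⟨hyS, hye⟩)
        (hPS.trans (sdiff_subset_sdiff_right (singleton_subset_iff.2 (mem_insert _ _)))), ?_⟩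
      rw [ncard_union_eq hdisj ((finite_singleton y).insert x) hPf, ncard_pair hxy, hP2]
    have hmap : ∀ C ∈ {C : Set α | M.IsCircuit C ∧ C.ncard = 5 ∧ e ∈ C ∧ C ⊆ M.closure X},
        C \ {e} ∈ {A : Set α | A ⊆ M.closure X \ {e} ∧ A.ncard = 4} \ {{x, y} ∪ P} := by
      intro C hC
      refine ⟨⟨sdiff_subset_sdiff_left hC.2.2.2, by rw [ncard_sdiff_singleton_of_mem hC.2.2.1, hC.2.1]⟩, ?_⟩
      intro hCA
      rw [mem_singleton_iff] at hCA
      have hsub : ({e, x, y} : Set α) ⊆ C := by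
        intro z hz
        simp only [mem_insert_iff, mem_singleton_iff] at hz
        rcases hz with rfl | rfl | rfl
        · exact hC.2.2.1
        · have hz' : z ∈ C \ {e} := by rw [hCA]; exact Or.inl (mem_insert _ _)
          exact hz'.1
        · have hz' : z ∈ C \ {e} := by rw [hCA]; exact Or.inl (mem_insert_of_mem _ (mem_singleton _))
          exact hz'.1
      have heq := hK.eq_of_subset_isCircuit hC.1 hsub
      have h3' := h3
      rw [heq, hC.2.1] at h3'
      omega
    have hinj : InjOn (fun C : Set α => C \ {e})
        {C : Set α | M.IsCircuit C ∧ C.ncard = 5 ∧ e ∈ C ∧ C ⊆ M.closure X} := by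
      intro C hC C' hC' h
      simp only at h
      have h1 : C = insert e (C \ {e}) := by rw [Set.insert_sdiff_singleton, Set.insert_eq_of_mem hC.2.2.1]
      have h2 : C' = insert e (C' \ {e}) := by rw [Set.insert_sdiff_singleton, Set.insert_eq_of_mem hC'.2.2.1]
      rw [h1, h2, h]
    have htgt : ({A : Set α | A ⊆ M.closure X \ {e} ∧ A.ncard = 4} \ {{x, y} ∪ P}).ncard =
        Nat.choose 6 4 - 1 := by
      rw [ncard_sdiff_singleton_of_mem hA₀, ncard_setOf_subset_ncard_eq' (hS₀f.subset sdiff_subset) 4, hS₀e]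
    have hval : Nat.choose 6 4 - 1 = 14 := by decide
    calc {C : Set α | M.IsCircuit C ∧ C.ncard = 5 ∧ e ∈ C ∧ C ⊆ M.closure X}.ncard
        ≤ ({A : Set α | A ⊆ M.closure X \ {e} ∧ A.ncard = 4} \ {{x, y} ∪ P}).ncard :=
          ncard_le_ncard_of_injOn _ hmap hinj (hbigfin.subset sdiff_subset)
      _ = Nat.choose 6 4 - 1 := htgt
      _ = 14 := hval
  omega

/-- **Case 1 in its five-circuit form**: if some five-circuit `C₀ ∋ e` spans a 7-point solid, at most `16` five-circuits pass
through `e`. -/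
theorem ncard_fiveCircuitsThrough_le_sixteen_of_seven_solid_circuit (M : Matroid α) [M.Finite]
    (hfree : ∀ e ∈ M.E, ∃ A ⊆ M.E \ {e}, e ∉ M.closure A ∧ e ∉ M.closure ((M.E \ {e}) \ A))
    (hns : ¬ ∃ W ⊆ M.E, W.ncard ≤ 9 ∧ W.encard = M.eRk W + 4) (hd : M.E.encard = M.eRank + 4)
    {e : α} {C₀ : Set α} (hC₀ : M.IsCircuit C₀) (h5₀ : C₀.ncard = 5) (heC₀ : e ∈ C₀) (h7 : (M.closure C₀).ncard = 7) :
    {C : Set α | M.IsCircuit C ∧ C.ncard = 5 ∧ e ∈ C}.ncard ≤ 16 :=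
  ncard_fiveCircuitsThrough_le_sixteen_of_seven_solid M hfree hns hd (eRk_eq_four_of_fiveCircuit M hC₀ h5₀)
    (M.subset_closure C₀ hC₀.subset_ground heC₀) h7

end S1

end PercRepro
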